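import Summits.QuantumFields.YangMills.Theorems.LogConcaveChartTransportPoincare
import Summits.QuantumFields.YangMills.Theorems.LogConcaveChartTransportGaussianSide
import Literature.MathematicalPhysics.QuantumFieldTheory.Balaban1983to89.B14Eq328GaussianIBP

/-!
# Route `LogConcaveChart` — toolkit for the support item `TransportCovarianceTransfer`
(stmt-QuantumFields-23668, child of the transport split of crux `QuadraticCovarianceComparison`,
stmt-QuantumFields-26240): **the transport remainder `R = q ∘ T − q` and its gradient**

For the quadratic observable `q(y) = yᵀHy + b·y` (`H` symmetric) and a `C¹` map `T` of `ℝⁿ`, the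
transport remainder `R := q ∘ T − q` has directional derivative
`∂ᵤR(x) = (2H(Tx) + b)·(DT(x)u − u) + 2H(Tx − x)·u` (`fderiv_remainder`), hence, when
`|DT − I| ≤ δ` pointwise, the squared gradient is dominated by
`∑ᵢ(∂ᵢR)² ≤ 2δ²|2H(Tx) + b|² + 8|H(Tx − x)|² ≤ 6δ²(4|Hx|² + 4|H(Tx − x)|² + |b|²) + 8|H(Tx − x)|²`
(`sum_sq_fderiv_remainder_le`, `sum_sq_fderiv_remainder_le'`).  Integrated against `γ = 𝒩(0, I)`
with the row-wise Poincaré bound `∫|H(T − id)|² ≤ (π²/8)δ²‖H‖_F²` of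
`LogConcaveChartTransportPoincare`, this is the dimension-free remainder control of the transport
proof of the covariance comparison.  Also: `contDiff_quadObs`, `hasFDerivAt_quadObs`,
`fderiv_quadObs`, `fderiv_displacement`, `dotProduct_mulVec_of_isSymm`, `dotProduct_self_add_three_le`.

HONEST SCOPE. Helper lemmas toward ONE support item of a sub-line; nothing here proves
`TransportCovarianceTransfer`, `QuadraticCovarianceComparison`, the `LogConcaveChart` thesis, rung
R2a (`BalabanLadder.NT`) or any summit statement; the Yang–Mills mass gap is NOT proved.
Filed by ideator seat ym-idea-8 (generation 8, lens «dual» = transport side).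
-/

namespace Summit.QuantumFields.YangMills.Cruxes.TransportCovarianceTransfer

open MeasureTheory ProbabilityTheory
open scoped NNReal ENNReal

variable {n : ℕ}

/-- For symmetric `H`: `x·(Hu) = (Hx)·u`. [folklore] -/
theorem dotProduct_mulVec_of_isSymm {H : Matrix (Fin n) (Fin n) ℝ} (hH : H.IsSymm)
    (x u : Fin n → ℝ) : x ⬝ᵥ H.mulVec u = H.mulVec x ⬝ᵥ u := by
  rw [Matrix.dotProduct_mulVec, ← Matrix.vecMul_transpose, hH.eq]

/-- The quadratic observable `q_{H,b}(y) = yᵀHy + b·y` is `C¹`. [folklore] -/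
theorem contDiff_quadObs (H : Matrix (Fin n) (Fin n) ℝ) (b : Fin n → ℝ) :
    ContDiff ℝ 1 fun y : Fin n → ℝ => y ⬝ᵥ H.mulVec y + b ⬝ᵥ y := by
  have e : (fun y : Fin n → ℝ => y ⬝ᵥ H.mulVec y + b ⬝ᵥ y) =
      fun y => (∑ i, ∑ j, H i j * (y i * y j)) + ∑ i, b i * y i := by
    funext y
    rw [quadForm_eq_sum, dotProduct_eq_sum]
  rw [e]
  have hc : ∀ i : Fin n, ContDiff ℝ 1 fun y : Fin n → ℝ => y i := fun i => contDiff_apply ℝ ℝ i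
  exact (ContDiff.sum fun i _ => ContDiff.sum fun j _ =>
    contDiff_const.mul ((hc i).mul (hc j))).add (ContDiff.sum fun i _ => contDiff_const.mul (hc i))

/-- **Derivative of the quadratic observable** (`H` symmetric): `Dq(x)u = (2Hx + b)·u`. [folklore] -/
theorem hasFDerivAt_quadObs {H : Matrix (Fin n) (Fin n) ℝ} (hH : H.IsSymm) (b x : Fin n → ℝ) :
    ∃ L : (Fin n → ℝ) →L[ℝ] ℝ, HasFDerivAt (fun y : Fin n → ℝ => y ⬝ᵥ H.mulVec y + b ⬝ᵥ y) L x ∧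
      ∀ u, L u = ((2 : ℝ) • H.mulVec x + b) ⬝ᵥ u := by
  obtain ⟨D, hD, hDu⟩ :=
    Literature.MathematicalPhysics.QuantumFieldTheory.Balaban1983to89.B14.Eq328GaussianIBP.hasFDerivAt_quadForm
      H x
  obtain ⟨Λ, hΛ⟩ := exists_clm_dotProduct b
  have hΛ' : HasFDerivAt (fun y : Fin n → ℝ => b ⬝ᵥ y) Λ x := by
    have e : (fun y : Fin n → ℝ => b ⬝ᵥ y) = ⇑Λ := funext fun y => (hΛ y).symm
    rw [e]
    exact Λ.hasFDerivAt
  refine ⟨D + Λ, hD.add hΛ', fun u => ?_⟩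
  rw [show (D + Λ) u = D u + Λ u from rfl, hDu, hΛ, dotProduct_mulVec_of_isSymm hH, add_dotProduct,
    smul_dotProduct, smul_eq_mul]
  ring

/-- `fderiv` form of `hasFDerivAt_quadObs`. [folklore] -/
theorem fderiv_quadObs {H : Matrix (Fin n) (Fin n) ℝ} (hH : H.IsSymm) (b x u : Fin n → ℝ) :
    fderiv ℝ (fun y : Fin n → ℝ => y ⬝ᵥ H.mulVec y + b ⬝ᵥ y) x u = ((2 : ℝ) • H.mulVec x + b) ⬝ᵥ u := by
  obtain ⟨L, hL, hLu⟩ := hasFDerivAt_quadObs hH b x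
  rw [hL.fderiv, hLu]

/-- `q_{H,b} ∘ T − q_{H,b}` is `C¹` for a `C¹` map `T`. [folklore] -/
theorem contDiff_remainder (H : Matrix (Fin n) (Fin n) ℝ) (b : Fin n → ℝ)
    {T : (Fin n → ℝ) → (Fin n → ℝ)} (hT : ContDiff ℝ 1 T) :
    ContDiff ℝ 1 fun y : Fin n → ℝ =>
      (T y ⬝ᵥ H.mulVec (T y) + b ⬝ᵥ T y) - (y ⬝ᵥ H.mulVec y + b ⬝ᵥ y) :=
  ((contDiff_quadObs H b).comp hT).sub (contDiff_quadObs H b)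

/-- **Derivative of the transport remainder.** For symmetric `H` and `C¹` `T`:
`∂ᵤ(q ∘ T − q)(x) = (2H(Tx) + b)·(DT(x)u − u) + 2H(Tx − x)·u`. [folklore] -/
theorem fderiv_remainder {H : Matrix (Fin n) (Fin n) ℝ} (hH : H.IsSymm) (b : Fin n → ℝ)
    {T : (Fin n → ℝ) → (Fin n → ℝ)} (hT : ContDiff ℝ 1 T) (x u : Fin n → ℝ) :
    fderiv ℝ (fun y : Fin n → ℝ =>
        (T y ⬝ᵥ H.mulVec (T y) + b ⬝ᵥ T y) - (y ⬝ᵥ H.mulVec y + b ⬝ᵥ y)) x u =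
      ((2 : ℝ) • H.mulVec (T x) + b) ⬝ᵥ (fderiv ℝ T x u - u) +
        ((2 : ℝ) • H.mulVec (T x - x)) ⬝ᵥ u := by
  obtain ⟨L₁, hL₁, hL₁u⟩ := hasFDerivAt_quadObs hH b (T x)
  obtain ⟨L₀, hL₀, hL₀u⟩ := hasFDerivAt_quadObs hH b x
  have hTx : HasFDerivAt T (fderiv ℝ T x) x := ((hT.differentiable one_ne_zero) x).hasFDerivAt
  have hc : HasFDerivAt (fun y : Fin n → ℝ => T y ⬝ᵥ H.mulVec (T y) + b ⬝ᵥ T y)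
      (L₁.comp (fderiv ℝ T x)) x := hL₁.comp x hTx
  have hR : HasFDerivAt (fun y : Fin n → ℝ =>
      (T y ⬝ᵥ H.mulVec (T y) + b ⬝ᵥ T y) - (y ⬝ᵥ H.mulVec y + b ⬝ᵥ y))
      (L₁.comp (fderiv ℝ T x) - L₀) x := hc.sub hL₀
  rw [hR.fderiv, show (L₁.comp (fderiv ℝ T x) - L₀) u = L₁ (fderiv ℝ T x u) - L₀ u from rfl, hL₁u,
    hL₀u]
  simp only [Matrix.mulVec_sub, smul_sub, add_dotProduct, sub_dotProduct, dotProduct_sub, smul_dotProduct,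
    smul_eq_mul]
  ring

/-- `∂ᵤ(T − id)(x) = DT(x)u − u`. [folklore] -/
theorem fderiv_displacement {T : (Fin n → ℝ) → (Fin n → ℝ)} (hT : ContDiff ℝ 1 T) (x u : Fin n → ℝ) :
    fderiv ℝ (fun y : Fin n → ℝ => T y - y) x u = fderiv ℝ T x u - u := by
  have hTx : HasFDerivAt T (fderiv ℝ T x) x := ((hT.differentiable one_ne_zero) x).hasFDerivAt
  have h : HasFDerivAt (fun y : Fin n → ℝ => T y - y)
      (fderiv ℝ T x - ContinuousLinearMap.id ℝ (Fin n → ℝ)) x := hTx.sub (hasFDerivAt_id x)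
  rw [h.fderiv]
  rfl

/-- `T − id` is `C¹`. [folklore] -/
theorem contDiff_displacement {T : (Fin n → ℝ) → (Fin n → ℝ)} (hT : ContDiff ℝ 1 T) :
    ContDiff ℝ 1 fun y : Fin n → ℝ => T y - y :=
  hT.sub contDiff_id

/-- `|u + v + z|² ≤ 3(|u|² + |v|² + |z|²)`. [folklore] -/
theorem dotProduct_self_add_three_le (u v z : Fin n → ℝ) :
    (u + v + z) ⬝ᵥ (u + v + z) ≤ 3 * (u ⬝ᵥ u + v ⬝ᵥ v + z ⬝ᵥ z) := by
  have h1 : 0 ≤ (u - v) ⬝ᵥ (u - v) := Finset.sum_nonneg fun _ _ => mul_self_nonneg _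
  have h2 : 0 ≤ (u - z) ⬝ᵥ (u - z) := Finset.sum_nonneg fun _ _ => mul_self_nonneg _
  have h3 : 0 ≤ (v - z) ⬝ᵥ (v - z) := Finset.sum_nonneg fun _ _ => mul_self_nonneg _
  have e1 : (u - v) ⬝ᵥ (u - v) = u ⬝ᵥ u - 2 * (u ⬝ᵥ v) + v ⬝ᵥ v := by
    simp only [sub_dotProduct, dotProduct_sub, dotProduct_comm v u]; ring
  have e2 : (u - z) ⬝ᵥ (u - z) = u ⬝ᵥ u - 2 * (u ⬝ᵥ z) + z ⬝ᵥ z := by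
    simp only [sub_dotProduct, dotProduct_sub, dotProduct_comm z u]; ring
  have e3 : (v - z) ⬝ᵥ (v - z) = v ⬝ᵥ v - 2 * (v ⬝ᵥ z) + z ⬝ᵥ z := by
    simp only [sub_dotProduct, dotProduct_sub, dotProduct_comm z v]; ring
  have e : (u + v + z) ⬝ᵥ (u + v + z) =
      u ⬝ᵥ u + v ⬝ᵥ v + z ⬝ᵥ z + 2 * (u ⬝ᵥ v) + 2 * (u ⬝ᵥ z) + 2 * (v ⬝ᵥ z) := by
    simp only [add_dotProduct, dotProduct_add, dotProduct_comm v u, dotProduct_comm z u,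
      dotProduct_comm z v]; ring
  rw [e1] at h1; rw [e2] at h2; rw [e3] at h3
  rw [e]
  linarith

/-- **Squared-gradient bound for the transport remainder.** If `|DT(x)u − u|² ≤ δ²|u|²` then
`∑ᵢ (∂ᵢ(q ∘ T − q)(x))² ≤ 2δ²|2H(Tx) + b|² + 8|H(Tx − x)|²`. [folklore] -/
theorem sum_sq_fderiv_remainder_le {δ : ℝ} {H : Matrix (Fin n) (Fin n) ℝ} (hH : H.IsSymm)
    (b : Fin n → ℝ) {T : (Fin n → ℝ) → (Fin n → ℝ)} (hT : ContDiff ℝ 1 T)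
    (hD : ∀ x u : Fin n → ℝ, (fderiv ℝ T x u - u) ⬝ᵥ (fderiv ℝ T x u - u) ≤ δ ^ 2 * (u ⬝ᵥ u))
    (x : Fin n → ℝ) :
    ∑ i, (fderiv ℝ (fun y : Fin n → ℝ =>
        (T y ⬝ᵥ H.mulVec (T y) + b ⬝ᵥ T y) - (y ⬝ᵥ H.mulVec y + b ⬝ᵥ y)) x (Pi.single i 1)) ^ 2 ≤
      2 * (δ ^ 2 * (((2 : ℝ) • H.mulVec (T x) + b) ⬝ᵥ ((2 : ℝ) • H.mulVec (T x) + b))) +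
        8 * (H.mulVec (T x - x) ⬝ᵥ H.mulVec (T x - x)) := by
  set w : Fin n → ℝ := (2 : ℝ) • H.mulVec (T x) + b with hw
  set v : Fin n → ℝ := H.mulVec (T x - x) with hv
  set L : (Fin n → ℝ) →L[ℝ] (Fin n → ℝ) := fderiv ℝ T x - ContinuousLinearMap.id ℝ (Fin n → ℝ) with hL
  have hLu : ∀ u, L u = fderiv ℝ T x u - u := fun u => by
    simp [hL]
  have hL' : ∀ u, L u ⬝ᵥ L u ≤ δ ^ 2 * (u ⬝ᵥ u) := fun u => by rw [hLu]; exact hD x u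
  have hterm : ∀ i, fderiv ℝ (fun y : Fin n → ℝ =>
      (T y ⬝ᵥ H.mulVec (T y) + b ⬝ᵥ T y) - (y ⬝ᵥ H.mulVec y + b ⬝ᵥ y)) x (Pi.single i 1) =
        w ⬝ᵥ L (Pi.single i 1) + 2 * v i := by
    intro i
    rw [fderiv_remainder hH b hT, hLu, smul_dotProduct, dotProduct_single_one, smul_eq_mul]
  simp_rw [hterm]
  have hsq : ∀ i, (w ⬝ᵥ L (Pi.single i 1) + 2 * v i) ^ 2 ≤
      2 * (w ⬝ᵥ L (Pi.single i 1)) ^ 2 + 8 * v i ^ 2 := fun i => by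
    nlinarith [sq_nonneg (w ⬝ᵥ L (Pi.single i 1) - 2 * v i)]
  have hA := sum_sq_dotProduct_apply_single_le L hL' w
  have hv2 : ∑ i, v i ^ 2 = v ⬝ᵥ v := by simp only [dotProduct, sq]
  calc ∑ i, (w ⬝ᵥ L (Pi.single i 1) + 2 * v i) ^ 2
      ≤ ∑ i, (2 * (w ⬝ᵥ L (Pi.single i 1)) ^ 2 + 8 * v i ^ 2) := Finset.sum_le_sum fun i _ => hsq i
    _ = 2 * ∑ i, (w ⬝ᵥ L (Pi.single i 1)) ^ 2 + 8 * ∑ i, v i ^ 2 := by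
        rw [Finset.sum_add_distrib, Finset.mul_sum, Finset.mul_sum]
    _ ≤ 2 * (δ ^ 2 * (w ⬝ᵥ w)) + 8 * (v ⬝ᵥ v) := by rw [hv2]; linarith

/-- `|2H(Tx) + b|² ≤ 3(4|Hx|² + 4|H(Tx − x)|² + |b|²)`. [folklore] -/
theorem weight_sq_le (H : Matrix (Fin n) (Fin n) ℝ) (b : Fin n → ℝ) (T : (Fin n → ℝ) → (Fin n → ℝ))
    (x : Fin n → ℝ) :
    ((2 : ℝ) • H.mulVec (T x) + b) ⬝ᵥ ((2 : ℝ) • H.mulVec (T x) + b) ≤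
      3 * (4 * (H.mulVec x ⬝ᵥ H.mulVec x) + 4 * (H.mulVec (T x - x) ⬝ᵥ H.mulVec (T x - x)) +
        b ⬝ᵥ b) := by
  have e : (2 : ℝ) • H.mulVec (T x) + b =
      (2 : ℝ) • H.mulVec x + (2 : ℝ) • H.mulVec (T x - x) + b := by
    rw [Matrix.mulVec_sub, smul_sub]; abel
  rw [e]
  have h := dotProduct_self_add_three_le ((2 : ℝ) • H.mulVec x) ((2 : ℝ) • H.mulVec (T x - x)) b
  have e1 : ((2 : ℝ) • H.mulVec x) ⬝ᵥ ((2 : ℝ) • H.mulVec x) = 4 * (H.mulVec x ⬝ᵥ H.mulVec x) := by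
    rw [smul_dotProduct, dotProduct_smul, smul_eq_mul, smul_eq_mul]; ring
  have e2 : ((2 : ℝ) • H.mulVec (T x - x)) ⬝ᵥ ((2 : ℝ) • H.mulVec (T x - x)) =
      4 * (H.mulVec (T x - x) ⬝ᵥ H.mulVec (T x - x)) := by
    rw [smul_dotProduct, dotProduct_smul, smul_eq_mul, smul_eq_mul]; ring
  rw [e1, e2] at h
  exact h

/-- **Dominated squared gradient of the transport remainder.** With `|DT − I| ≤ δ` pointwise:
`∑ᵢ (∂ᵢ(q ∘ T − q)(x))² ≤ 6δ²(4|Hx|² + 4|H(Tx − x)|² + |b|²) + 8|H(Tx − x)|²`. [folklore] -/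
theorem sum_sq_fderiv_remainder_le' {δ : ℝ} {H : Matrix (Fin n) (Fin n) ℝ} (hH : H.IsSymm)
    (b : Fin n → ℝ) {T : (Fin n → ℝ) → (Fin n → ℝ)} (hT : ContDiff ℝ 1 T)
    (hD : ∀ x u : Fin n → ℝ, (fderiv ℝ T x u - u) ⬝ᵥ (fderiv ℝ T x u - u) ≤ δ ^ 2 * (u ⬝ᵥ u))
    (x : Fin n → ℝ) :
    ∑ i, (fderiv ℝ (fun y : Fin n → ℝ =>
        (T y ⬝ᵥ H.mulVec (T y) + b ⬝ᵥ T y) - (y ⬝ᵥ H.mulVec y + b ⬝ᵥ y)) x (Pi.single i 1)) ^ 2 ≤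
      6 * δ ^ 2 * (4 * (H.mulVec x ⬝ᵥ H.mulVec x) +
          4 * (H.mulVec (T x - x) ⬝ᵥ H.mulVec (T x - x)) + b ⬝ᵥ b) +
        8 * (H.mulVec (T x - x) ⬝ᵥ H.mulVec (T x - x)) := by
  have h1 := sum_sq_fderiv_remainder_le hH b hT hD x
  have h2 := weight_sq_le H b T x
  have hδ : 0 ≤ δ ^ 2 := sq_nonneg _
  nlinarith [h1, h2, mul_le_mul_of_nonneg_left h2 hδ]

end Summit.QuantumFields.YangMills.Cruxes.TransportCovarianceTransfer
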